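import Summits.ResolutionOfSingularities.ResolutionOfSingularities.Theorems.FrobeniusLadderFInjectiveMacaulayficationLocalFullificationFibreAdmGe4Split
import Literature.AlgebraicGeometry.Resolution.FBlowupVarieties
import HarnessLib

/-!
# THE F-CENTRE CANDIDATE «L-FB_adm(d)»: Yasuda's F-blowup as the canonical centre for the F-half (LF_adm-F) of door v36.2
# (crux `FInjectiveMacaulayfication` stmt-ResolutionOfSingularities-15315, chain w45a; res-L1-w45a-plan-1 STEER R17.10 / ERRATUM R17.10a
# adopting res-L1-w45a-tri-2 #334 (c); plan-1 GO 01:33:49Z; seat res-L1-w45a-stub-1 g8)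

[OURS · L1 W4.5a] Support file (`--supports stmt-ResolutionOfSingularities-15315 --as helper`); replaces the role of NO printed item; NOT a
statement of the manuscript; NOT in the cone of door v36.2's `_proof` — a NAMED TARGET for specimens (idea-1 programme K2WILD-r5 «F-centre»), like
the `…Split` files. Two CANDIDATE statements (`@[conjecture] def`, consumed only as hypotheses; no instance, no notation, no named fact) and their
PROVED projections onto the registered F-half. AI-written (AI review is weaker than expert review).

## The census object
The F-half of the registered residue of door v36.2 is (LF_adm-F) `LocalFullificationFibreAdmGe4Split.LocalFInjectivizationFibreAdmGe4`
(res-L1-w45a-stub-2, p591179): for `d ≥ 4`, `X/k` integral separated of finite type (`char k = p`), a SINGULAR CLOSED point `x` with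
`dim 𝒪_{X,x} = d`, an ADMISSIBLE (`supp I ⊆ Sing`) blowing up `g : S′ → Spec 𝒪_{X,x}` along `I ≠ ⊥` that is regular off the closed fibre and
Cohen–Macaulay everywhere, find a fibre-supported `𝓚 ≠ ⊥` on `S′` all of whose blowings up are FULL (`SliceableCentre.FullCl`: domain ∧
CM-clause ∧ Frobenius-closed parameter ideals) at every point. The census object **L-FB_adm** proposes ONE CANONICAL CANDIDATE for `𝓚`: a centre
whose blowing up is Yasuda's `e`-th **F-blowup** `FB_e(S′) → S′` [Yasuda 2012, Def. 2.2; Cor. 2.6: projective, birational, an isomorphism over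
`S′_sm`; Prop. 2.7: an isomorphism iff `S′` smooth], in the tree's blow-up rendering `Literature.AlgebraicGeometry.Resolution.IsFBlowup p e π`
(`FBlowup.lean`: over every nonempty affine open, `π` is the blowing up of a Frobenius norm ideal `[[F^e_* Γ(S′, U)]]`).

* `LFBAdm p e d` — **L-FB_adm(p, e, d), FIXED EXPONENT** (plan-1 01:33:49Z (a)): for every level-`d` specimen `S′` of (LF_adm-F) in characteristic
  `p` there is `𝓚 ≠ ⊥`, fibre-cosupported AND admissible (`supp 𝓚 ⊆ Sing S′`), such that every blowing up of `S′` along `𝓚` IS an `e`-th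
  F-blowup of `S′` and is FULL at every point.
* `LFBAdmSome d` — **L-FB_adm(d)** (tri-2 #334 (c) VERBATIM, adopted R17.10a (2)): the same with `∃ e` chosen PER SPECIMEN.
* PROVED: `lFBAdmSome_of_lFBAdm` (uniform exponent ⇒ some exponent), **`localFInjectivizationFibreAdmGe4_of_lFBAdmSome`** and
  **`localFInjectivizationFibreAdmGe4_of_lFBAdm`** (⇒ the registered F-half, by projection: drop the F-blowup and admissibility conjuncts — no
  lemma owed, as tri-2 #334 (c) predicted), and the two instance suppliers a specimen filer needs to state the `IsFBlowup` clause on a local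
  blow-up scheme: `isIntegral_of_isBlowup_stalk`, `expChar_functionField_of_isBlowup_stalk`.

## The side question P-FB (prose only; not typed here)
«Is `FB_e(S′)` `S′`-isomorphic to a Sing-admissible blowing up?» — YES when the Frobenius norm sheaf `N` has invertible bidual (e.g. `S′`
factorial along `Sing S′`; isolated complete-intersection points of dimension `≥ 4` by parafactoriality [SGA 2, Exp. XI, Cor. 3.14]); OPEN in
general; NOT automatic: tri-2's witness `X = {xy = zw}`, `X′ = Bl_{(x,z)} X` is a blowing up, an isomorphism off `0`, with exceptional set `ℙ¹`
of codimension 2, hence not a `0`-admissible blowing up (R17.10a (1) withdrew «iso over `S′_reg` ⇒ automatically admissible»). This is why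
admissibility and «every blowing up along `𝓚` is an F-blowup» are CONJUNCTS of the census object rather than consequences.
presearch (tri-2 01:33:43Z): [corpus: paper:arxiv-2304.13247 §7, Rem. 7.2, Ex. 7.7] toric evidence that `FB_e` is divisorial; no printed
statement settles P-FB for non-toric non-normal CM `S′`.

## Record behind the candidate (dimension 2; rung 0 of the census line)
[HaraSawadaYasuda2011 = arXiv:1108.1840]: Prop. 3.7 (F-blowups of the non-F-regular rational double points = partial resolutions dominated by the
minimal one), Thm. 4.14 (non-F-pure simple elliptic `Ẽ₈`, `E² = −1`: the normalisation of `FB_e` is `Bl_{(t,u^{p^e−1})}` of the minimal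
resolution), Ex. 4.16 / Lemma 4.17 (`p = 3`: `FB₁` normal with one `A₁` point). Caveat of record: in `d ≥ 3` the object is `FB_e` ITSELF, never its
normalisation, and FULL must hold at EVERY point.

[candidate statements, OURS; cite: Yasuda2012, Def. 2.2; Cor. 2.6; Prop. 2.7] [cite: HaraSawadaYasuda2011, Prop. 3.7; Thm. 4.14; Ex. 4.16]
[cite: Villamayoru2006, Thm. 3.3 and 3.4] [cite: Temkin2008, Prop. 2.3.4 (iii) (the admissible category)]
-/

-- single-problem summit: the doubled namespace component is forced
set_option linter.dupNamespace false

noncomputable section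

open AlgebraicGeometry CategoryTheory CategoryTheory.Limits Literature.AlgebraicGeometry.Resolution TopologicalSpace IsLocalRing

namespace Summit.ResolutionOfSingularities.ResolutionOfSingularities.Theorems.FInjectiveMacaulayfication.FCentreCandidate

open Summit.ResolutionOfSingularities.ResolutionOfSingularities.Theorems.FInjectiveMacaulayfication
open SliceableCentre

/-! ## §1 The census objects -/

/-- [OURS · CANDIDATE statement, not a fact] **L-FB_adm(p, e, d) — FIXED EXPONENT.** Binders VERBATIM those of (LF_adm-F)
`LocalFullificationFibreAdmGe4Split.LocalFInjectivizationFibreAdmGe4` at level `d` and characteristic `p` (`X/k` integral separated of finite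
type, `char k = p`; SINGULAR CLOSED `x` with `dim 𝒪_{X,x} = d`; `g : S′ → Spec 𝒪_{X,x}` an ADMISSIBLE blowing up along `I ≠ ⊥`, regular off the
closed fibre, Cohen–Macaulay everywhere). Conclusion: an ideal sheaf `𝓚 ≠ ⊥` on `S′`, supported in the closed fibre AND in `Sing S′`
(admissible), such that EVERY blowing up `π : S″ → S′` along `𝓚` is an `e`-th F-blowup of `S′` (`IsFBlowup p e π`, for the integral structure
of `S′` and the characteristic-`p` instance of its function field — both hold here, `isIntegral_of_isBlowup_stalk` /
`expChar_functionField_of_isBlowup_stalk`) and is FULL (`SliceableCentre.FullCl p`) at EVERY point. Vacuous unless `p` is prime.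
«Candidate, not a claim; currency target for idea-1 K2WILD-r5 (e = 1 first).»
[candidate statement, OURS; cite: Yasuda2012, Def. 2.2; Cor. 2.6] -/
@[conjecture] def LFBAdm (p e d : ℕ) : Prop :=
  p.Prime → ∀ (k : Type) [Field k] [CharP k p]
    (X : Scheme.{0}) (f : X ⟶ Spec (.of k)),
      IsSeparated f → LocallyOfFiniteType f → QuasiCompact f → IsIntegral X →
      ∀ x : X, IsClosed ({x} : Set X) → x ∉ Scheme.regularLocus X → ringKrullDim (X.presheaf.stalk x) = d →
      ∀ (S' : Scheme.{0}) (g : S' ⟶ Spec (X.presheaf.stalk x)) (I : (Spec (X.presheaf.stalk x)).IdealSheafData),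
        I ≠ ⊥ → (I.support : Set (Spec (X.presheaf.stalk x))) ⊆ (Scheme.regularLocus (Spec (X.presheaf.stalk x)))ᶜ → IsBlowup g I →
        (∀ s : S', g.base s ≠ closedPoint (X.presheaf.stalk x) → s ∈ Scheme.regularLocus S') →
        (∀ s : S', CMCl (S'.presheaf.stalk s)) →
        ∃ 𝓚 : S'.IdealSheafData, 𝓚 ≠ ⊥ ∧ (∀ s ∈ (𝓚.support : Set S'), g.base s = closedPoint (X.presheaf.stalk x)) ∧
          (𝓚.support : Set S') ⊆ (Scheme.regularLocus S')ᶜ ∧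
          (∀ [IsIntegral S'] [ExpChar S'.functionField p] (S'' : Scheme.{0}) (π : S'' ⟶ S'), IsBlowup π 𝓚 → IsFBlowup p e π) ∧
          ∀ (S'' : Scheme.{0}) (π : S'' ⟶ S'), IsBlowup π 𝓚 →
            ∀ s : S'', FullCl p (S''.presheaf.stalk s)

/-- [OURS · CANDIDATE statement, not a fact] **L-FB_adm(d)** (res-L1-w45a-tri-2 #334 (c), adopted by res-L1-w45a-plan-1 R17.10a (2), VERBATIM):
«for `S′` as in `LocalFInjectivizationFibreAdmGe4` at level `d`, ∃ `e` ∃ `𝓚 : S′.IdealSheafData`, `𝓚 ≠ ⊥`, fibre-cosupported ∧ admissible, the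
blowing up of `𝓚` `IsFBlowup p e` ∧ every blowing up along `𝓚` is FULL at every point» — the exponent `e` chosen PER SPECIMEN. Binders VERBATIM
those of (LF_adm-F). «Candidate, not a claim.» [candidate statement, OURS; cite: Yasuda2012, Def. 2.2; Cor. 2.6] -/
@[conjecture] def LFBAdmSome (d : ℕ) : Prop :=
  ∀ (p : ℕ), p.Prime → ∀ (k : Type) [Field k] [CharP k p]
    (X : Scheme.{0}) (f : X ⟶ Spec (.of k)),
      IsSeparated f → LocallyOfFiniteType f → QuasiCompact f → IsIntegral X →
      ∀ x : X, IsClosed ({x} : Set X) → x ∉ Scheme.regularLocus X → ringKrullDim (X.presheaf.stalk x) = d →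
      ∀ (S' : Scheme.{0}) (g : S' ⟶ Spec (X.presheaf.stalk x)) (I : (Spec (X.presheaf.stalk x)).IdealSheafData),
        I ≠ ⊥ → (I.support : Set (Spec (X.presheaf.stalk x))) ⊆ (Scheme.regularLocus (Spec (X.presheaf.stalk x)))ᶜ → IsBlowup g I →
        (∀ s : S', g.base s ≠ closedPoint (X.presheaf.stalk x) → s ∈ Scheme.regularLocus S') →
        (∀ s : S', CMCl (S'.presheaf.stalk s)) →
        ∃ (e : ℕ) (𝓚 : S'.IdealSheafData), 𝓚 ≠ ⊥ ∧ (∀ s ∈ (𝓚.support : Set S'), g.base s = closedPoint (X.presheaf.stalk x)) ∧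
          (𝓚.support : Set S') ⊆ (Scheme.regularLocus S')ᶜ ∧
          (∀ [IsIntegral S'] [ExpChar S'.functionField p] (S'' : Scheme.{0}) (π : S'' ⟶ S'), IsBlowup π 𝓚 → IsFBlowup p e π) ∧
          ∀ (S'' : Scheme.{0}) (π : S'' ⟶ S'), IsBlowup π 𝓚 →
            ∀ s : S'', FullCl p (S''.presheaf.stalk s)

/-! ## §2 The instance suppliers for the `IsFBlowup` clause on a local blow-up scheme -/

/-- A blowing up of `Spec 𝒪_{X,x}` (`X` integral) along a non-zero ideal sheaf is an integral scheme. [cite: StacksProject, Tag 02ND] -/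
theorem isIntegral_of_isBlowup_stalk {X : Scheme.{0}} [IsIntegral X] (x : X)
    {S' : Scheme.{0}} {g : S' ⟶ Spec (X.presheaf.stalk x)} {I : (Spec (X.presheaf.stalk x)).IdealSheafData}
    (hI : I ≠ ⊥) (hg : IsBlowup g I) : IsIntegral S' :=
  hg.isIntegral hI

/-- The function field of a blowing up of `Spec 𝒪_{X,x}` (`X` an integral `k`-scheme, `char k = p` prime) has exponential characteristic `p`
(through the composite `S′ → Spec 𝒪_{X,x} → X → Spec k`). [folklore] -/
theorem expChar_functionField_of_isBlowup_stalk (p : ℕ) (hp : p.Prime) {k : Type} [Field k] [CharP k p]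
    {X : Scheme.{0}} (f : X ⟶ Spec (.of k)) [IsIntegral X] (x : X)
    {S' : Scheme.{0}} {g : S' ⟶ Spec (X.presheaf.stalk x)} {I : (Spec (X.presheaf.stalk x)).IdealSheafData}
    (hI : I ≠ ⊥) (hg : IsBlowup g I) :
    haveI := isIntegral_of_isBlowup_stalk x hI hg
    ExpChar S'.functionField p := by
  haveI := isIntegral_of_isBlowup_stalk x hI hg
  haveI : ExpChar k p := ExpChar.prime hp
  exact expChar_functionField_of_hom (g ≫ X.fromSpecStalk x ≫ f) p

/-! ## §3 The projections -/

/-- **Uniform exponent ⇒ some exponent**: `(∀ p prime, ∃ e, L-FB_adm(p, e, d)) ⇒ L-FB_adm(d)`. [folklore] -/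
theorem lFBAdmSome_of_lFBAdm {d : ℕ} (h : ∀ p : ℕ, p.Prime → ∃ e : ℕ, LFBAdm p e d) : LFBAdmSome d := by
  intro p hp k _ _ X f hsep hft hqc hint x hxcl hxs hx S' g I hI hIadm hg hreg hcm
  obtain ⟨e, he⟩ := h p hp
  obtain ⟨𝓚, h1, h2, h3, h4, h5⟩ := he hp k X f hsep hft hqc hint x hxcl hxs hx S' g I hI hIadm hg hreg hcm
  exact ⟨e, 𝓚, h1, h2, h3, h4, h5⟩

/-- **L-FB_adm(d) for all `d ≥ 4` ⇒ (LF_adm-F) `LocalFInjectivizationFibreAdmGe4`** — by projection (the exponent, the admissibility of `𝓚`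
and the F-blowup clause are simply dropped); «no lemma owed» (tri-2 #334 (c)). [folklore] -/
theorem localFInjectivizationFibreAdmGe4_of_lFBAdmSome (h : ∀ d : ℕ, 4 ≤ d → LFBAdmSome d) :
    LocalFullificationFibreAdmGe4Split.LocalFInjectivizationFibreAdmGe4 := by
  intro d hd p hp k _ _ X f hsep hft hqc hint x hxcl hxs hx S' g I hI hIadm hg hreg hcm
  obtain ⟨-, 𝓚, h1, h2, -, -, h5⟩ := h d hd p hp k X f hsep hft hqc hint x hxcl hxs hx S' g I hI hIadm hg hreg hcm
  exact ⟨𝓚, h1, h2, h5⟩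

/-- **`(∀ d ≥ 4, ∀ p prime, ∃ e, L-FB_adm(p, e, d))` ⇒ (LF_adm-F)** (res-L1-w45a-plan-1 01:33:49Z (b), the fixed-exponent reading). [folklore] -/
theorem localFInjectivizationFibreAdmGe4_of_lFBAdm (h : ∀ d : ℕ, 4 ≤ d → ∀ p : ℕ, p.Prime → ∃ e : ℕ, LFBAdm p e d) :
    LocalFullificationFibreAdmGe4Split.LocalFInjectivizationFibreAdmGe4 :=
  localFInjectivizationFibreAdmGe4_of_lFBAdmSome fun d hd => lFBAdmSome_of_lFBAdm (h d hd)

end Summit.ResolutionOfSingularities.ResolutionOfSingularities.Theorems.FInjectiveMacaulayfication.FCentreCandidate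

end
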